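import Summits.QuantumFields.YangMills.Theorems.UnitScaleTiltProp7OneFormPointwiseDecayE2E
import Summits.QuantumFields.YangMills.Theorems.UnitScaleTiltProp7OneFormBlockDecayAll
import HarnessLib

/-!
# Route `UnitScaleTilt`, crux K1 «MinimiserStabilityRegPr» (stmt-QuantumFields-19200), EX face S46 — (L3′b)-VALUE, ONE-FORM STOREY, FILE (K2):
# **THE KERNEL ROW OF `G₀ = Δ_a(U₀)⁻¹` AT THE SLOT OF RECORD, IN O4e's `hk` CURRENCY** — O4-E2E ✓`pointwiseDecay_oneForm_DeltaEtaSlot` specialised to the single-bond sources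
# `toL2 (Pi.single b Z)`, its `hD` letter taken from A4b ✓`blockDecay_allBlocks_of_letters`, the rate made UNIFORM over the (finitely many) sources

Cell `ym3-torus` (HUMAN RULING D-0037; rung R3 = SU(2) YM₃ on T³ — NOT d = 4, NOT infinite volume, NOT a mass gap, NOT Clay).  Chair ★`ym-ust-19200-p1` g26 CHAIR WORD №14 «GO (K2) FIRST»;
typed by width seat `ym3-torus-px16` g13 (`--supports stmt-QuantumFields-19200 --as helper`).  THEOREMS ONLY (0 `def`, 0 `sorry`, default heartbeats); count-neutral.

WHY.  Print's road from `G₀ = (Δ + DRD* + Q*aQ)⁻¹` (p.421) to the slots of the EX rows (`Δ₁ = Pᵀ(Δ^η + T_J)P`) is the perturbation series (3.129)–(3.137); its bookkeeping multiplies KERNEL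
ROWS.  O4-E2E gives the pointwise decay of ONE solution `u` of `Δ_a u = f` for a block-supported source, with an `∃ κ₁ ∈ (0, r]` chosen AFTER the source; the kernel row of the OPERATOR
`G₀ := GT … (DeltaEtaSlot) U₀` needs (i) the source `δ_b Z`, (ii) the `hD` letter of that solution (A4b, from the displayed Gårding∕Agmon letters), and (iii) ONE rate for ALL `(b, Z)`.
(iii) is finite bookkeeping: `Z ↦ G₀(toL2 δ_bZ)` is linear, `M₂(ℂ)` is spanned by the four `E_{ij}`, the bonds are finitely many, and a decay bound at rate `κ` is a decay bound at every
smaller rate — so the MINIMUM of the finitely many E2E rates serves all sources.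
WHAT IS PROVED (ns `Summit.QuantumFields.YangMills.Theorems.Prop7OneFormGreenKernelRow`; member `F`, `n K`, `ℓ = L^{K−n} = η⁻¹`).
* §1 letters of the single-bond source: `norm_frobEquiv_symm_single_one` (`‖frobEquiv⁻¹E_{ij}‖ = 1`), `norm_entry_le_sqrt_two_mul_norm` (`|Z_{ij}| ≤ √2|Z|`), `norm_toL2_pi_single`
  (`‖toL2 δ_bE‖ = √c₀·‖frobEquiv⁻¹E‖`), `norm_equiv_toL2_pi_single_le` (`‖(toL2 δ_bE)(p)‖ ≤ ‖frobEquiv⁻¹E‖`), `iterBlockOf_eq_of_equiv_toL2_pi_single_ne_zero` (support), and the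
  linear decomposition `map_toL2_pi_single_eq_sum` (`G(toL2 δ_bZ) = Σ_{ij} Z_{ij} • G(toL2 δ_bE_{ij})`).
* §2 ★ `exists_uniform_rate_of_finite` — the finite-minimum device: per-index rates `∃ κ ∈ (0, r]` for a rate-monotone property ⟹ one rate for all indices.
* §3 ★★★ `kernelRow_GT_DeltaEtaSlot` — on `RegPr F n K ε₀ U₀` and the class `PosOnto` (print's Thm 3.11 + «Q onto», displayed), with A4b's letters (γ) `hco`, (C_V) `hVlow`, (θ_V) `hVconj`
  (uniform over `rη`-Lipschitz phases), `0 < Θ_r := (1−ε)γ − εC_V − 3r²e^{2r}(1+1∕ε) − θ_V` (the K-FREE floor of A4b's `Θ` by ✓`eta_sq_exp_sub_one_sq_le`), the kernel rows `hkD`, `hkQ` at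
  rate `μ′ > r` (E2E's text) and `(32√2ε₀e^{5r})(8e^{3r})·14 < 1`:
  `∃ κ₁ ∈ (0, r], ∀ b Z bd, ‖toL2⁻¹(G₀(toL2 δ_bZ)) bd‖ ≤ (4√2·A₁)·e^{−κ₁·tdist(B b₋, B bd₋)}·‖Z‖`, `A₁` = E2E's constant at `Fsrc := 1`, `D₀ := e^{6r}√c₀∕Θ_r` — O4e's `hk` text for `B := G₀`.
HONEST SCOPE.  Bookkeeping over E2E and A4b; CONDITIONAL on (γ)(C_V)(θ_V), `hkD` (✓-fed for the member), `hkQ` (px21 ✓`hkQ_of_col` mod (COL)), `PosOnto`; nothing of the ten EX rows,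
`hT`, (3.42) for print's `G`∕`H`, EX or the crux is proved here; no summit is proved by a helper.  The rate `κ₁` is existential (E2E's), uniform in the source; K-freeness of `κ₁` is that
of O4b's cosh rate (`min` of finitely many copies of the SAME E2E rate).

References: T. Bałaban, CMP **99** (1985) 389–434 [Balaban1985BackgroundPropagators] (Thm 3.1 (3.42) p.397, (3.46) p.398, (3.49) p.399, (3.129)–(3.137) pp.421–422, Thm 3.12 p.422);
CMP **98** (1985) 17–51 [Balaban1985Averaging] ((18)–(20) p.21).
-/

set_option autoImplicit false

noncomputable section

open scoped Matrix.Norms.L2Operator BigOperators InnerProductSpace ComplexConjugate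

namespace Summit.QuantumFields.YangMills.Theorems.Prop7OneFormGreenKernelRow

open Literature.MathematicalPhysics.QuantumFieldTheory.Balaban1983to89
open Literature.MathematicalPhysics.QuantumFieldTheory.Balaban1983to89.T3ContinuumYM3Torus
open Literature.MathematicalPhysics.QuantumFieldTheory.Balaban1983to89.T3PrintedRegularMinimiser (RegPr)
open T3SectALandauChart (formComp bgUnits eta eta_pos)
open B4Sect5Torus (TSite)
open B9SectCLatticeCarrier (Bond)
open B9Eq311L2Pairing (WL2)
open B11Eq103H1Complex (BondL2K)
open B5Eq118OneStroke (iterBlockOf)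
open B3Taylor310LocalRemainder (tdist_comm)
open Summit.QuantumFields.YangMills.Theorems.Prop7SectET3Transport (periodsT3 siteEquiv bondEquiv bondEquiv_symm_apply)
open Summit.QuantumFields.YangMills.Theorems.Prop7SectET3HilbertLetters (W₂ frobEquiv toL2 toL2S DL2 DstarL2 toL2_apply toL2_symm_apply)
open Summit.QuantumFields.YangMills.Theorems.Prop7SectET3WilsonHessian (DeltaEta DeltaEtaSlot)
open Summit.QuantumFields.YangMills.Theorems.Prop7SectET3GaugeProjector (RS)
open Summit.QuantumFields.YangMills.Theorems.Prop7SectET3CurvedPropagators (laplaceA Qk GT PosOnto laplaceA_GT)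
open Summit.QuantumFields.YangMills.Theorems.Prop7RieszTauFrobNorm (norm_frobEquiv_le norm_sq_frobEquiv_symm sum_norm_sq_le_two_mul_opNorm_sq)
open Summit.QuantumFields.YangMills.Theorems.Prop7LaplaceAFlatLetters (norm_sq_toL2)
open Summit.QuantumFields.YangMills.Theorems.Prop7OneFormPointwiseDecayE2E (pointwiseDecay_oneForm_DeltaEtaSlot)
open Summit.QuantumFields.YangMills.Theorems.Prop7OneFormBlockDecayAll (blockDecay_allBlocks_of_letters eta_sq_exp_sub_one_sq_le)

variable {F : T3Family} {n K : ℕ} {c₀ : ℝ}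

/-! ## §1 Letters of the single-bond source `δ_b Z` -/

/-- `‖frobEquiv⁻¹(E_{ij})‖ = 1` for the matrix unit `E_{ij} = single i j 1`. [cite: Balaban1985Averaging, (18) p.21] -/
theorem norm_frobEquiv_symm_single_one (i j : Fin 2) : ‖(frobEquiv.symm (Matrix.single i j (1 : ℂ)) : W₂)‖ = 1 := by
  have h : ‖(frobEquiv.symm (Matrix.single i j (1 : ℂ)) : W₂)‖ ^ 2 = 1 := by
    rw [norm_sq_frobEquiv_symm, Fin.sum_univ_two, Fin.sum_univ_two, Fin.sum_univ_two]
    fin_cases i <;> fin_cases j <;> simp [Matrix.single]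
  have h0 : 0 ≤ ‖(frobEquiv.symm (Matrix.single i j (1 : ℂ)) : W₂)‖ := norm_nonneg _
  nlinarith [h, h0]

/-- `|Z_{ij}| ≤ √2·|Z|` (operator norm; ✓`sum_norm_sq_le_two_mul_opNorm_sq`). [cite: Balaban1985Averaging, (20) p.21] -/
theorem norm_entry_le_sqrt_two_mul_norm (Z : Matrix (Fin 2) (Fin 2) ℂ) (i j : Fin 2) : ‖Z i j‖ ≤ Real.sqrt 2 * ‖Z‖ := by
  have h := sum_norm_sq_le_two_mul_opNorm_sq Z
  have h1 : ‖Z i j‖ ^ 2 ≤ ∑ i', ∑ j', ‖Z i' j'‖ ^ 2 := by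
    have hi : ∑ j', ‖Z i j'‖ ^ 2 ≤ ∑ i', ∑ j', ‖Z i' j'‖ ^ 2 :=
      Finset.single_le_sum (f := fun i' => ∑ j', ‖Z i' j'‖ ^ 2) (fun i' _ => Finset.sum_nonneg fun j' _ => by positivity) (Finset.mem_univ i)
    exact (Finset.single_le_sum (f := fun j' => ‖Z i j'‖ ^ 2) (fun j' _ => by positivity) (Finset.mem_univ j)).trans hi
  have h2 : ‖Z i j‖ ^ 2 ≤ (Real.sqrt 2 * ‖Z‖) ^ 2 := by
    rw [mul_pow, Real.sq_sqrt (by norm_num : (0 : ℝ) ≤ 2)]; exact h1.trans h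
  exact (pow_le_pow_iff_left₀ (norm_nonneg _) (by positivity) two_ne_zero).mp h2

/-- `‖toL2 (δ_b E)‖ = √c₀·‖frobEquiv⁻¹ E‖` (✓`norm_sq_toL2`, ✓`norm_sq_frobEquiv_symm`). [cite: Balaban1985BackgroundPropagators, (3.11) p.392] -/
theorem norm_toL2_pi_single [Fact (0 < c₀)] (b : PBond (F.P K) 0) (E : Matrix (Fin 2) (Fin 2) ℂ) :
    ‖toL2 F K c₀ (Pi.single b E)‖ = Real.sqrt c₀ * ‖(frobEquiv.symm E : W₂)‖ := by
  classical
  have hc₀ : 0 < c₀ := Fact.out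
  have h : ‖toL2 F K c₀ (Pi.single b E)‖ ^ 2 = (Real.sqrt c₀ * ‖(frobEquiv.symm E : W₂)‖) ^ 2 := by
    rw [norm_sq_toL2, mul_pow, Real.sq_sqrt hc₀.le, norm_sq_frobEquiv_symm]
    congr 1
    rw [Finset.sum_eq_single b]
    · rw [Pi.single_eq_same]
    · intro b' _ hb'
      refine Finset.sum_eq_zero fun i _ => Finset.sum_eq_zero fun j _ => ?_
      rw [Pi.single_eq_of_ne hb', Matrix.zero_apply, norm_zero]; simp
    · intro hb; exact absurd (Finset.mem_univ b) hb
  exact (pow_left_inj₀ (norm_nonneg _) (by positivity) two_ne_zero).mp h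

/-- `‖(toL2 δ_bE)(p)‖ ≤ ‖frobEquiv⁻¹E‖` at every lit bond `p` (value `frobEquiv⁻¹E` on `bondEquiv b`, `0` elsewhere). [cite: Balaban1985BackgroundPropagators, (3.11) p.392] -/
theorem norm_equiv_toL2_pi_single_le (b : PBond (F.P K) 0) (E : Matrix (Fin 2) (Fin 2) ℂ) (p : Bond 3 (periodsT3 F K)) :
    ‖WL2.equiv ℂ _ W₂ (toL2 F K c₀ (Pi.single b E)) p‖ ≤ ‖(frobEquiv.symm E : W₂)‖ := by
  classical
  rw [toL2_apply]
  by_cases hb : (bondEquiv F K).symm p = b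
  · rw [hb, Pi.single_eq_same]
  · rw [Pi.single_eq_of_ne hb, map_zero, norm_zero]; exact norm_nonneg _

/-- SUPPORT: if `(toL2 δ_bE)(p) ≠ 0` then `p`'s source lies in the block of `b₋`. [folklore] -/
theorem iterBlockOf_eq_of_equiv_toL2_pi_single_ne_zero (b : PBond (F.P K) 0) (E : Matrix (Fin 2) (Fin 2) ℂ) (p : Bond 3 (periodsT3 F K))
    (hp : WL2.equiv ℂ _ W₂ (toL2 F K c₀ (Pi.single b E)) p ≠ 0) :
    iterBlockOf (K - n) ((bondEquiv F K).symm p).src = iterBlockOf (K - n) b.src := by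
  classical
  rw [toL2_apply] at hp
  by_cases hb : (bondEquiv F K).symm p = b
  · rw [hb]
  · rw [Pi.single_eq_of_ne hb, map_zero] at hp; exact absurd rfl hp

/-- LINEARITY IN THE SOURCE VALUE: `G(toL2 δ_bZ) = Σ_{ij} Z_{ij} • G(toL2 δ_bE_{ij})` for every linear `G`. [folklore] -/
theorem map_toL2_pi_single_eq_sum (G : BondL2K ℂ 3 (periodsT3 F K) c₀ W₂ →ₗ[ℂ] BondL2K ℂ 3 (periodsT3 F K) c₀ W₂) (b : PBond (F.P K) 0)
    (Z : Matrix (Fin 2) (Fin 2) ℂ) :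
    G (toL2 F K c₀ (Pi.single b Z)) = ∑ i : Fin 2, ∑ j : Fin 2, Z i j • G (toL2 F K c₀ (Pi.single b (Matrix.single i j (1 : ℂ)))) := by
  classical
  have h1 : (Pi.single b Z : PBond (F.P K) 0 → Matrix (Fin 2) (Fin 2) ℂ)
      = ∑ i : Fin 2, ∑ j : Fin 2, Z i j • (Pi.single b (Matrix.single i j (1 : ℂ)) : PBond (F.P K) 0 → Matrix (Fin 2) (Fin 2) ℂ) := by
    ext b' : 1
    simp only [Finset.sum_apply, Pi.smul_apply]
    by_cases hb : b' = b
    · subst hb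
      simp only [Pi.single_eq_same, Matrix.smul_single, smul_eq_mul, mul_one]
      exact Matrix.matrix_eq_sum_single Z
    · simp only [Pi.single_eq_of_ne hb, smul_zero, Finset.sum_const_zero]
  rw [h1, map_sum, map_sum]
  refine Finset.sum_congr rfl fun i _ => ?_
  rw [map_sum, map_sum]
  refine Finset.sum_congr rfl fun j _ => ?_
  rw [map_smul, map_smul]

/-! ## §2 The finite-minimum device: one rate for finitely many sources -/

/-- ★ **ONE RATE FOR ALL INDICES**: if for every index of a finite nonempty type there is a rate `κ ∈ (0, r]` with a property that persists at every SMALLER positive rate, then one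
rate `κ ∈ (0, r]` serves all indices (the minimum, ✓`Finite.exists_min`). [folklore] -/
theorem exists_uniform_rate_of_finite {ι : Type*} [Finite ι] [Nonempty ι] {r : ℝ} {P : ι → ℝ → Prop}
    (hmono : ∀ i (κ κ' : ℝ), 0 < κ' → κ' ≤ κ → P i κ → P i κ')
    (h : ∀ i, ∃ κ : ℝ, 0 < κ ∧ κ ≤ r ∧ P i κ) : ∃ κ : ℝ, 0 < κ ∧ κ ≤ r ∧ ∀ i, P i κ := by
  choose κ hκ using h
  obtain ⟨i₀, hi₀⟩ := Finite.exists_min κ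
  exact ⟨κ i₀, (hκ i₀).1, (hκ i₀).2.1, fun i => hmono i (κ i) (κ i₀) (hκ i₀).1 (hi₀ i) (hκ i).2.2⟩

/-! ## §3 The kernel row of `G₀` at the slot of record -/

variable [Fact (0 < c₀)] {h : n ≤ K} {cB a : ℝ} [Fact (0 < cB)]

/-- ★★★ **THE KERNEL ROW OF `G₀ = Δ_a(U₀)⁻¹` AT `DeltaEtaSlot`, IN O4e's `hk` CURRENCY.**  On `RegPr F n K ε₀ U₀`, on the class `PosOnto` (Δ_a positive, `Q_k` onto — so `Δ_a G₀ = 1`,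
✓`laplaceA_GT`), with A4b's letters (γ) `hco`, (C_V) `hVlow`, (θ_V) `hVconj` for every `rη`-Lipschitz phase (A4b v1.1's class `|φ x − φ x′| ≤ rη·tdist x x′`), the K-free floor `0 < Θ_r := (1−ε)γ − εC_V − 3r²e^{2r}(1+1∕ε) − θ_V`, the
kernel rows `hkD` (of `D(1−R_S)D*`) and `hkQ` (of `Q_k†(a•Q_k)`) at rate `μ′ > r`, and `(32√2ε₀e^{5r})(8e^{3r})·14 < 1`: there is ONE rate `κ₁ ∈ (0, r]` with, for ALL `b Z bd`,
`‖toL2⁻¹(G₀(toL2 δ_bZ)) bd‖ ≤ (4√2·A₁)·e^{−κ₁·tdist(B b₋, B bd₋)}·‖Z‖`, `A₁` = E2E's constant at `Fsrc := 1`, `D₀ := e^{6r}√c₀∕Θ_r` — E2E ✓`pointwiseDecay_oneForm_DeltaEtaSlot` per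
source `δ_bE_{ij}` (`hD` by A4b ✓`blockDecay_allBlocks_of_letters`), then §2 over `(b, i, j)` and §1's linearity.  CONDITIONAL on every displayed letter.
[cite: Balaban1985BackgroundPropagators, Thm 3.1 (3.42) p.397, (3.46) p.398, (3.49) p.399, Thm 3.12 p.422] -/
theorem kernelRow_GT_DeltaEtaSlot (hnK : n ≤ K) {ε₀ : ℝ} (hε₀ : 0 ≤ ε₀) (U₀ : GaugeField (F.P K) 0 (Matrix.specialUnitaryGroup (Fin 2) ℂ)) (hreg : RegPr F n K ε₀ U₀)
    (hp : PosOnto F n K h c₀ cB a (DeltaEtaSlot F n K c₀) U₀)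
    {r : ℝ} (hr : 0 < r) {γ CV θV ε : ℝ} (hε : 0 < ε) (hε1 : ε ≤ 1)
    (hco : ∀ v : BondL2K ℂ 3 (periodsT3 F K) c₀ W₂, γ * ‖v‖ ^ 2 ≤ RCLike.re ⟪v, laplaceA F n K h c₀ cB a (DeltaEtaSlot F n K c₀) U₀ v⟫_ℂ)
    (hVlow : ∀ X : PBond (F.P K) 0 → Matrix (Fin 2) (Fin 2) ℂ,
      -(CV * ‖toL2 F K c₀ X‖ ^ 2) ≤ RCLike.re ⟪toL2 F K c₀ X, laplaceA F n K h c₀ cB a (DeltaEtaSlot F n K c₀) U₀ (toL2 F K c₀ X)⟫_ℂ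
        - ∑ μ : Fin (F.P K).d, ‖DL2 F n K c₀ U₀ (toL2S F K c₀ (formComp X μ))‖ ^ 2)
    (hVconj : ∀ φ : Site (F.P K) 0 → ℝ, (∀ x x' : Site (F.P K) 0, |φ x - φ x'| ≤ r * eta F n K * (Site.tdist x x' : ℝ)) →
      ∀ X : PBond (F.P K) 0 → Matrix (Fin 2) (Fin 2) ℂ,
      RCLike.re ⟪toL2 F K c₀ X, laplaceA F n K h c₀ cB a (DeltaEtaSlot F n K c₀) U₀ (toL2 F K c₀ X)⟫_ℂ
          - (∑ μ : Fin (F.P K).d, ‖DL2 F n K c₀ U₀ (toL2S F K c₀ (formComp X μ))‖ ^ 2) - θV * ‖toL2 F K c₀ X‖ ^ 2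
        ≤ RCLike.re ⟪toL2 F K c₀ (fun b => Real.exp (φ b.src) • X b), laplaceA F n K h c₀ cB a (DeltaEtaSlot F n K c₀) U₀ (toL2 F K c₀ (fun b => (Real.exp (φ b.src))⁻¹ • X b))⟫_ℂ
          - RCLike.re (∑ μ : Fin (F.P K).d, ⟪DL2 F n K c₀ U₀ (toL2S F K c₀ (formComp (fun b => Real.exp (φ b.src) • X b) μ)),
              DL2 F n K c₀ U₀ (toL2S F K c₀ (formComp (fun b => (Real.exp (φ b.src))⁻¹ • X b) μ))⟫_ℂ))
    (hΘ : 0 < (1 - ε) * γ - ε * CV - 3 * (r ^ 2 * Real.exp (2 * r)) * (1 + 1 / ε) - θV)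
    {CkD CkQ μ' : ℝ} (hCkD : 0 ≤ CkD) (hCkQ : 0 ≤ CkQ) (hrμ : r < μ')
    (hkD : ∀ (b : PBond (F.P K) 0) (Z : Matrix (Fin 2) (Fin 2) ℂ) (bd : PBond (F.P K) 0),
      ‖(toL2 F K c₀).symm (DL2 F n K c₀ U₀ (DstarL2 F n K c₀ U₀ (toL2 F K c₀ (Pi.single b Z))
          - RS F n K h c₀ cB U₀ (DstarL2 F n K c₀ U₀ (toL2 F K c₀ (Pi.single b Z))))) bd‖
        ≤ CkD * Real.exp (-(μ' * (Site.tdist (P := F.P K) (iterBlockOf (K - n) b.src) (iterBlockOf (K - n) bd.src) : ℝ))) * ‖Z‖)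
    (hkQ : ∀ (b : PBond (F.P K) 0) (Z : Matrix (Fin 2) (Fin 2) ℂ) (bd : PBond (F.P K) 0),
      ‖(toL2 F K c₀).symm (LinearMap.adjoint (Qk F n K h c₀ cB U₀) (((a : ℝ) : ℂ) • Qk F n K h c₀ cB U₀ (toL2 F K c₀ (Pi.single b Z)))) bd‖
        ≤ CkQ * Real.exp (-(μ' * (Site.tdist (P := F.P K) (iterBlockOf (K - n) b.src) (iterBlockOf (K - n) bd.src) : ℝ))) * ‖Z‖)
    (hsmall : (32 * Real.sqrt 2 * ε₀ * Real.exp (5 * r)) * (8 * Real.exp (3 * r)) * 14 < 1) :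
    ∃ κ₁ : ℝ, 0 < κ₁ ∧ κ₁ ≤ r ∧ ∀ (b : PBond (F.P K) 0) (Z : Matrix (Fin 2) (Fin 2) ℂ) (bd : PBond (F.P K) 0),
      ‖(toL2 F K c₀).symm (GT F n K h c₀ cB a (DeltaEtaSlot F n K c₀) U₀ (toL2 F K c₀ (Pi.single b Z))) bd‖
        ≤ 4 * Real.sqrt 2 *
          (((1 + Real.sqrt 2 * ((CkQ + CkD) * Real.sqrt (((F.P K).d : ℝ) * ((((F.P K).L : ℝ) ^ (F.P K).d) ^ (K - n)) / c₀) * (Real.exp (6 * r) * Real.sqrt c₀ / ((1 - ε) * γ - ε * CV - 3 * (r ^ 2 * Real.exp (2 * r)) * (1 + 1 / ε) - θV)) * (2 * (1 + 1 / (μ' - r))) ^ 3)) * (8 * Real.exp (3 * r)) * 14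
              + Real.sqrt (3 ^ 3 * 8 / (c₀ * ((F.L : ℝ) ^ (K - n)) ^ 3)) * (Real.sqrt (8 * Real.exp (3 * r) * (2 * (1 + 1 / r)) ^ 3) * (Real.exp (6 * r) * Real.sqrt c₀ / ((1 - ε) * γ - ε * CV - 3 * (r ^ 2 * Real.exp (2 * r)) * (1 + 1 / ε) - θV))))
            / (1 - (32 * Real.sqrt 2 * ε₀ * Real.exp (5 * r)) * (8 * Real.exp (3 * r)) * 14))
          * Real.exp (-(κ₁ * (Site.tdist (P := F.P K) (iterBlockOf (K - n) b.src) (iterBlockOf (K - n) bd.src) : ℝ))) * ‖Z‖ := by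
  classical
  have hc₀ : 0 < c₀ := Fact.out
  -- abbreviations
  set Θ : ℝ := (1 - ε) * γ - ε * CV - 3 * (r ^ 2 * Real.exp (2 * r)) * (1 + 1 / ε) - θV with hΘdef
  set D₀ : ℝ := Real.exp (6 * r) * Real.sqrt c₀ / Θ with hD₀def
  have hD₀ : 0 ≤ D₀ := by rw [hD₀def]; exact div_nonneg (by positivity) hΘ.le
  set A₁ : ℝ := (((1 + Real.sqrt 2 * ((CkQ + CkD) * Real.sqrt (((F.P K).d : ℝ) * ((((F.P K).L : ℝ) ^ (F.P K).d) ^ (K - n)) / c₀) * D₀ * (2 * (1 + 1 / (μ' - r))) ^ 3)) * (8 * Real.exp (3 * r)) * 14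
        + Real.sqrt (3 ^ 3 * 8 / (c₀ * ((F.L : ℝ) ^ (K - n)) ^ 3)) * (Real.sqrt (8 * Real.exp (3 * r) * (2 * (1 + 1 / r)) ^ 3) * D₀))
      / (1 - (32 * Real.sqrt 2 * ε₀ * Real.exp (5 * r)) * (8 * Real.exp (3 * r)) * 14)) with hA₁def
  have hden : 0 < 1 - (32 * Real.sqrt 2 * ε₀ * Real.exp (5 * r)) * (8 * Real.exp (3 * r)) * 14 := by linarith
  have hμr : 0 < μ' - r := by linarith
  have hA₁ : 0 ≤ A₁ := by rw [hA₁def]; exact div_nonneg (by positivity) hden.le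
  -- A4b's `Θ` dominates the K-free floor
  have hΘle : Θ ≤ (1 - ε) * γ - ε * CV - 3 * ((eta F n K)⁻¹) ^ 2 * (Real.exp (r * eta F n K) - 1) ^ 2 * (1 + 1 / ε) - θV := by
    have h1 := eta_sq_exp_sub_one_sq_le F n K hr.le
    have h2 : 0 ≤ 1 + 1 / ε := by positivity
    have h3 : 3 * (((eta F n K)⁻¹) ^ 2 * (Real.exp (r * eta F n K) - 1) ^ 2) * (1 + 1 / ε) ≤ 3 * (r ^ 2 * Real.exp (2 * r)) * (1 + 1 / ε) :=
      mul_le_mul_of_nonneg_right (mul_le_mul_of_nonneg_left h1 (by norm_num)) h2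
    rw [hΘdef]; linarith
  have hΘA : 0 ≤ (1 - ε) * γ - ε * CV - 3 * ((eta F n K)⁻¹) ^ 2 * (Real.exp (r * eta F n K) - 1) ^ 2 * (1 + 1 / ε) - θV := hΘ.le.trans hΘle
  -- STEP 1: E2E per source `δ_b E_{ij}`
  have hsrc : ∀ t : PBond (F.P K) 0 × Fin 2 × Fin 2, ∃ κ₁ : ℝ, 0 < κ₁ ∧ κ₁ ≤ r ∧ ∀ bd : PBond (F.P K) 0,
      ‖(toL2 F K c₀).symm (GT F n K h c₀ cB a (DeltaEtaSlot F n K c₀) U₀ (toL2 F K c₀ (Pi.single t.1 (Matrix.single t.2.1 t.2.2 (1 : ℂ))))) bd‖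
        ≤ A₁ * Real.exp (-(κ₁ * (Site.tdist (P := F.P K) (iterBlockOf (K - n) t.1.src) (iterBlockOf (K - n) bd.src) : ℝ))) := by
    rintro ⟨b, i, j⟩
    set E : Matrix (Fin 2) (Fin 2) ℂ := Matrix.single i j (1 : ℂ) with hE
    have hE1 : ‖(frobEquiv.symm E : W₂)‖ = 1 := norm_frobEquiv_symm_single_one i j
    set f : BondL2K ℂ 3 (periodsT3 F K) c₀ W₂ := toL2 F K c₀ (Pi.single b E) with hf
    set u : BondL2K ℂ 3 (periodsT3 F K) c₀ W₂ := GT F n K h c₀ cB a (DeltaEtaSlot F n K c₀) U₀ f with hu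
    have hu' : laplaceA F n K h c₀ cB a (DeltaEtaSlot F n K c₀) U₀ u = f := laplaceA_GT hp f
    set v : Site (F.P K) (K - n) := iterBlockOf (K - n) b.src with hv
    -- the source letters
    have hfb : ∀ p, ‖WL2.equiv ℂ _ W₂ f p‖ ≤ 1 := fun p => (norm_equiv_toL2_pi_single_le b E p).trans hE1.le
    have hfs : ∀ p, WL2.equiv ℂ _ W₂ f p ≠ 0 → iterBlockOf (K - n) ((bondEquiv F K).symm p).src = v := fun p hp0 =>
      iterBlockOf_eq_of_equiv_toL2_pi_single_ne_zero b E p hp0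
    -- the `hD` letter by A4b
    have hXf : ∀ b' : PBond (F.P K) 0, (Pi.single b E : PBond (F.P K) 0 → Matrix (Fin 2) (Fin 2) ℂ) b' ≠ 0 → iterBlockOf (K - n) b'.src = v := by
      intro b' hb'
      by_cases hbb : b' = b
      · rw [hbb]
      · rw [Pi.single_eq_of_ne hbb] at hb'; exact absurd rfl hb'
    have hnf : ‖toL2 F K c₀ (Pi.single b E)‖ = Real.sqrt c₀ := by rw [norm_toL2_pi_single, hE1, mul_one]
    have hD : ∀ y : Site (F.P K) (K - n),
        ‖toL2 F K c₀ (fun b' => if iterBlockOf (K - n) b'.src = y then (toL2 F K c₀).symm u b' else 0)‖ ≤ D₀ * Real.exp (-(r * (Site.tdist y v : ℝ))) := by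
      intro y
      have hA4 := blockDecay_allBlocks_of_letters (h := h) (cB := cB) (a := a) (Δx := DeltaEtaSlot F n K c₀) hnK U₀ hr.le hε hε1 hco hVlow hVconj hΘA
        (Pi.single b E) v hXf u hu' y
      rw [hnf] at hA4
      -- divide by `Θ ≤ Θ_A4b`
      have hnum : Θ * ‖toL2 F K c₀ (fun b' => if iterBlockOf (K - n) b'.src = y then (toL2 F K c₀).symm u b' else 0)‖
          ≤ Real.exp (6 * r) * Real.exp (-(r * (Site.tdist y v : ℝ))) * Real.sqrt c₀ :=
        (mul_le_mul_of_nonneg_right hΘle (norm_nonneg _)).trans hA4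
      rw [← le_div_iff₀' hΘ] at hnum
      refine hnum.trans (le_of_eq ?_)
      rw [hD₀def]; ring
    -- E2E
    obtain ⟨κ₁, hκ₁0, hκ₁r, hbd⟩ := pointwiseDecay_oneForm_DeltaEtaSlot (h := h) (cB := cB) (a := a) hnK hε₀ U₀ hreg hu' v hfb hfs hr hD₀ hD hCkD hCkQ hrμ hkD hkQ hsmall
    refine ⟨κ₁, hκ₁0, hκ₁r, fun bd => ?_⟩
    have h1 := hbd (bondEquiv F K bd)
    rw [Equiv.symm_apply_apply] at h1
    rw [toL2_symm_apply]
    refine (norm_frobEquiv_le _).trans (h1.trans (le_of_eq ?_))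
    rw [tdist_comm (iterBlockOf (K - n) bd.src) v, hA₁def]
  -- STEP 2: one rate for all sources
  have hmono : ∀ (t : PBond (F.P K) 0 × Fin 2 × Fin 2) (κ κ' : ℝ), 0 < κ' → κ' ≤ κ →
      (∀ bd : PBond (F.P K) 0, ‖(toL2 F K c₀).symm (GT F n K h c₀ cB a (DeltaEtaSlot F n K c₀) U₀ (toL2 F K c₀ (Pi.single t.1 (Matrix.single t.2.1 t.2.2 (1 : ℂ))))) bd‖
        ≤ A₁ * Real.exp (-(κ * (Site.tdist (P := F.P K) (iterBlockOf (K - n) t.1.src) (iterBlockOf (K - n) bd.src) : ℝ)))) →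
      (∀ bd : PBond (F.P K) 0, ‖(toL2 F K c₀).symm (GT F n K h c₀ cB a (DeltaEtaSlot F n K c₀) U₀ (toL2 F K c₀ (Pi.single t.1 (Matrix.single t.2.1 t.2.2 (1 : ℂ))))) bd‖
        ≤ A₁ * Real.exp (-(κ' * (Site.tdist (P := F.P K) (iterBlockOf (K - n) t.1.src) (iterBlockOf (K - n) bd.src) : ℝ)))) := by
    intro t κ κ' hκ' hκκ hb bd
    refine (hb bd).trans (mul_le_mul_of_nonneg_left (Real.exp_le_exp.mpr ?_) hA₁)
    have : 0 ≤ (Site.tdist (P := F.P K) (iterBlockOf (K - n) t.1.src) (iterBlockOf (K - n) bd.src) : ℝ) := Nat.cast_nonneg _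
    nlinarith
  haveI : Nonempty (PBond (F.P K) 0 × Fin 2 × Fin 2) := ⟨(⟨default, ⟨0, by rw [T3Family.P_d]; norm_num⟩⟩, 0, 0)⟩
  obtain ⟨κ₁, hκ₁0, hκ₁r, hall⟩ := exists_uniform_rate_of_finite hmono hsrc
  refine ⟨κ₁, hκ₁0, hκ₁r, fun b Z bd => ?_⟩
  -- STEP 3: linearity in `Z`
  rw [map_toL2_pi_single_eq_sum, map_sum, Finset.sum_apply]
  have hterm : ∀ i j : Fin 2, ‖((toL2 F K c₀).symm (Z i j • GT F n K h c₀ cB a (DeltaEtaSlot F n K c₀) U₀ (toL2 F K c₀ (Pi.single b (Matrix.single i j (1 : ℂ)))))) bd‖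
      ≤ Real.sqrt 2 * ‖Z‖ * (A₁ * Real.exp (-(κ₁ * (Site.tdist (P := F.P K) (iterBlockOf (K - n) b.src) (iterBlockOf (K - n) bd.src) : ℝ)))) := by
    intro i j
    rw [map_smul, Pi.smul_apply, norm_smul]
    exact mul_le_mul (norm_entry_le_sqrt_two_mul_norm Z i j) (hall (b, i, j) bd) (norm_nonneg _) (by positivity)
  calc ‖∑ i : Fin 2, ((toL2 F K c₀).symm (∑ j : Fin 2, Z i j • GT F n K h c₀ cB a (DeltaEtaSlot F n K c₀) U₀ (toL2 F K c₀ (Pi.single b (Matrix.single i j (1 : ℂ)))))) bd‖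
      ≤ ∑ i : Fin 2, ‖((toL2 F K c₀).symm (∑ j : Fin 2, Z i j • GT F n K h c₀ cB a (DeltaEtaSlot F n K c₀) U₀ (toL2 F K c₀ (Pi.single b (Matrix.single i j (1 : ℂ)))))) bd‖ :=
        norm_sum_le _ _
    _ ≤ ∑ i : Fin 2, ∑ j : Fin 2, Real.sqrt 2 * ‖Z‖ * (A₁ * Real.exp (-(κ₁ * (Site.tdist (P := F.P K) (iterBlockOf (K - n) b.src) (iterBlockOf (K - n) bd.src) : ℝ)))) := by
        refine Finset.sum_le_sum fun i _ => ?_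
        rw [map_sum, Finset.sum_apply]
        exact (norm_sum_le _ _).trans (Finset.sum_le_sum fun j _ => hterm i j)
    _ = _ := by
        simp only [Finset.sum_const, Finset.card_univ, Fintype.card_fin, nsmul_eq_mul]
        rw [hA₁def]; push_cast; ring

end Summit.QuantumFields.YangMills.Theorems.Prop7OneFormGreenKernelRow

end
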